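import Mathlib
import Summits.ResolutionOfSingularities.ResolutionOfSingularities.Theorems.CleanModels.Negative.CossartPiltant2019Thm15iFrameOrdTowerKindS
import HarnessLib

/-!
# Towards `OrdTowerShape 5`: the point blow-up of `S` along `ord_𝔪` is the valuation ring (roadmap T3, `I → III`)

Support lemma (INPUTS seat res-inputs-p-cp15frame g1, 2026-08-28) for the residual hypothesis `OrdTowerShape 5` of
`CossartPiltant2019_thm_1_5_i_frame_false_of_ordTowerShape` (crux `CleanModels`, stmt-ResolutionOfSingularities-15917; ROADMAP in
`run/shared/lean/pub/res-hironaka/plan/inputs/p-cp15frame/HANDOFF.md` § g1):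

* `OrdWitness.eq_valuationSubring_of_isLocalBlowupAlong_maximalIdeal` — **the local blowing up of the first tower member
  `B = range (S → K)` along its CLOSED POINT (centre `𝔪_B`) with respect to `O = ord_𝔪` IS `O`**: the chart generator `u₀` has
  order `1`, every polynomial of order `≥ m` lies in `(X)ᵐ`, so every `h = a/b ∈ O` (`ord a ≥ ord b = m`) is the quotient
  `(a/u₀ᵐ)/(b/u₀ᵐ)` of two elements of `B[𝔪/u₀]` with denominator of value `1` — res-inputs-crit-1 R190 (3): «centre 𝔪_S: the
  O-centre of S[𝔪/u₀] is (u₀), the generic point of the exceptional plane, so the local blow-up IS the DVR O».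
* the order lemmas it needs: `OrdWitness.valuation_span_le` (an element of the ideal spanned by the chart generators has value at
  most that of `u₀`, and its quotient by `u₀` lies in the blown-up algebra) and `OrdWitness.eq_expNeg_one_of_le_of_lt` (discreteness).

Together with the earlier files this settles every tower `S → O → O → ⋯` (point first) and the kinds `S`, `O`; the curve blow-ups
`B♯` (roadmap T2, T4 `I → II → III`, T5-II) remain.  Nothing here proves or refutes resolution of singularities in characteristic
`p`; [OURS · NEGATIVE-SUPPORT] counted 0.
-/

noncomputable section

set_option linter.dupNamespace false -- mandated namespace of this single-conjunct summit

open MvPolynomial IsLocalRing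
open Literature.AlgebraicGeometry.Resolution Literature.AlgebraicGeometry.Resolution.WeightedBlowup

namespace Summit.ResolutionOfSingularities.ResolutionOfSingularities.Theorems.CleanModels.Negative

namespace OrdWitness

variable (p : ℕ) [hp : Fact p.Prime]

omit hp in
/-- Discreteness of `ℤᵐ⁰`: a value in `[exp (−1), 1)` is `exp (−1)`. [folklore] -/
theorem eq_expNeg_one_of_le_of_lt {v : WithZero (Multiplicative ℤ)} (h1 : expNeg 1 ≤ v) (h2 : v < 1) : v = expNeg 1 := by
  have hv0 : v ≠ 0 := by
    intro e; rw [e] at h1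
    exact (expNeg_ne_zero 1) (le_antisymm h1 zero_le)
  obtain ⟨z, rfl⟩ := WithZero.ne_zero_iff_exists.mp hv0
  rw [expNeg, WithZero.coe_le_coe, ← Multiplicative.toAdd_le, toAdd_ofAdd] at h1
  rw [← WithZero.coe_one, WithZero.coe_lt_coe, ← Multiplicative.toAdd_lt, toAdd_one] at h2
  rw [expNeg, WithZero.coe_inj]
  have h3 : Multiplicative.toAdd z = -((1 : ℕ) : ℤ) := by push_cast at h1 ⊢; omega
  rw [← h3, ofAdd_toAdd]

omit hp in
/-- `exp (−1)^m = exp (−m)`. [folklore] -/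
theorem expNeg_one_pow (m : ℕ) : expNeg 1 ^ m = expNeg m := by
  induction m with
  | zero => rw [pow_zero, expNeg_zero]
  | succ k ih => rw [pow_succ, ih, ← expNeg_add]

/-- **Inside the blown-up algebra.**  For a subring `B ⊆ O` and chart data `u, u₀` of a local blowing up (every generator of value
at most that of `u₀`): every element `y` of the ideal spanned by `u` has value at most that of `u₀`, and `y/u₀` lies in
`B[u/u₀]`. [folklore] -/
theorem valuation_span_le {B : Subring (K p)} (hBO : B ≤ (O p).toSubring) {u : Finset B} {u₀ : B}
    (hval : ∀ x ∈ u, (O p).valuation (x : K p) ≤ (O p).valuation (u₀ : K p)) {y : B}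
    (hy : y ∈ Ideal.span (↑u : Set B)) :
    (O p).valuation (y : K p) ≤ (O p).valuation (u₀ : K p) ∧
      (y : K p) / u₀ ∈ Subring.closure ((B : Set (K p)) ∪ (fun x : B => (x : K p) / u₀) '' ↑u) := by
  set C := Subring.closure ((B : Set (K p)) ∪ (fun x : B => (x : K p) / u₀) '' ↑u)
  induction hy using Submodule.span_induction with
  | mem x hx => exact ⟨hval x hx, Subring.subset_closure (Or.inr ⟨x, hx, rfl⟩)⟩
  | zero => exact ⟨by simp, by simp⟩
  | add x y _ _ hx hy =>
    refine ⟨?_, ?_⟩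
    · rw [Subring.coe_add]
      exact (Valuation.map_add _ _ _).trans (max_le hx.1 hy.1)
    · rw [Subring.coe_add, add_div]
      exact C.add_mem hx.2 hy.2
  | smul a x _ hx =>
    refine ⟨?_, ?_⟩
    · rw [smul_eq_mul, Subring.coe_mul, map_mul]
      have ha : (O p).valuation (a : K p) ≤ 1 := ((O p).valuation_le_one_iff _).mpr (hBO a.2)
      calc (O p).valuation (a : K p) * (O p).valuation (x : K p)
          ≤ 1 * (O p).valuation (u₀ : K p) := mul_le_mul' ha hx.1
        _ = (O p).valuation (u₀ : K p) := one_mul _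
    · rw [smul_eq_mul, Subring.coe_mul, mul_div_assoc]
      exact C.mul_mem (Subring.subset_closure (Or.inl a.2)) hx.2

/-- **Roadmap T3 (`I → III`): blowing up the closed point of `S` along `ord_𝔪` gives the valuation ring `O` itself.**  For the
member `B = range (S → K)` and the centre `P = 𝔪_B`: if `B'` is a local blowing up of `B` along `P` with respect to `O = ord_𝔪`,
then `B' = O`.  The chart generator `u₀` has order exactly `1` (`X₀ ∈ 𝔪_B` has order `1` and `u₀` has the least order in
`𝔪_B`); a polynomial of order `≥ m` lies in `(X)ᵐ` and so, divided by `u₀ᵐ`, in `B[𝔪/u₀]`; hence `h = a/b ∈ O`, with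
`ord a ≥ ord b = m`, is `(a/u₀ᵐ)/(b/u₀ᵐ) ∈ B[𝔪/u₀]_{centre} = B'`, the denominator having value `1`. [folklore] -/
theorem eq_valuationSubring_of_isLocalBlowupAlong_maximalIdeal (B B' : Subring (K p))
    (hB : B = (algebraMap (S p) (K p)).range) [IsLocalRing B] {P : Ideal B} (hP : P = maximalIdeal B)
    (H : IsLocalBlowupAlong (O p) B P B') : B' = (O p).toSubring := by
  have htarget : B' ≤ (O p).toSubring := H.isLocalBlowup.target_le
  subst hB
  obtain ⟨hBO, u, u₀, hspan, hu₀, hne, hval, rfl⟩ := H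
  set C := Subring.closure (((algebraMap (S p) (K p)).range : Set (K p)) ∪
    (fun x : (algebraMap (S p) (K p)).range => (x : K p) / u₀) '' ↑u) with hC
  have hequiv := Valuation.isEquiv_valuation_valuationSubring (ordVK p)
  -- `u₀` has order exactly `1`
  have hu₀m : u₀ ∈ maximalIdeal (algebraMap (S p) (K p)).range := hP ▸ hspan ▸ Ideal.subset_span hu₀
  have hu₀lt : ordVK p (u₀ : K p) < 1 := by
    rw [← valuation_O_lt_one_iff]
    exact (mem_maximalIdeal_iff_valuation_lt_one (range_le_O p) (locAtCentre_range_eq p) u₀).mp hu₀m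
  have hX0m : toRange p (X 0) ∈ Ideal.span (↑u : Set (algebraMap (S p) (K p)).range) := by
    rw [hspan, hP]
    exact toRange_mem_maximalIdeal p (by rw [RingHom.mem_ker, constantCoeff_X])
  have hX0le := (valuation_span_le p hBO hval hX0m).1
  rw [coe_toRange] at hX0le
  have hu₀v : ordVK p (u₀ : K p) = expNeg 1 := by
    apply eq_expNeg_one_of_le_of_lt _ hu₀lt
    rw [← ordVK_X0 p]
    exact (hequiv.le_iff_le).mpr hX0le
  have hu₀0 : (u₀ : K p) ≠ 0 := by
    intro e; have := hu₀v; rw [e, map_zero] at this; exact (expNeg_ne_zero 1) this.symm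
  -- the ideals `J m = {y : 𝔽_p[X] | y / u₀ᵐ ∈ C}` contain `(X)ᵐ`
  let J : ℕ → Ideal (Poly p) := fun m =>
    { carrier := {y | algebraMap (Poly p) (K p) y / (u₀ : K p) ^ m ∈ C}
      add_mem' := fun {a b} ha hb => by
        show algebraMap (Poly p) (K p) (a + b) / (u₀ : K p) ^ m ∈ C
        rw [map_add, add_div]; exact C.add_mem ha hb
      zero_mem' := by
        show algebraMap (Poly p) (K p) 0 / (u₀ : K p) ^ m ∈ C
        rw [map_zero, zero_div]; exact C.zero_mem
      smul_mem' := fun c {a} ha => by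
        show algebraMap (Poly p) (K p) (c • a) / (u₀ : K p) ^ m ∈ C
        rw [smul_eq_mul, map_mul, mul_div_assoc]
        refine C.mul_mem (Subring.subset_closure (Or.inl ?_)) ha
        rw [← coe_toRange]; exact (toRange p c).2 }
  have hJmem : ∀ m (y : Poly p), y ∈ J m ↔ algebraMap (Poly p) (K p) y / (u₀ : K p) ^ m ∈ C := fun m y => Iff.rfl
  have hJ0 : origin p ^ 0 ≤ J 0 := by
    intro y _
    rw [hJmem, pow_zero, div_one, ← coe_toRange]
    exact Subring.subset_closure (Or.inl (toRange p y).2)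
  have hJ1 : origin p ≤ J 1 := by
    intro y hy
    rw [hJmem, pow_one, ← coe_toRange]
    have hy' : toRange p y ∈ Ideal.span (↑u : Set (algebraMap (S p) (K p)).range) := by
      rw [hspan, hP]; exact toRange_mem_maximalIdeal p hy
    exact (valuation_span_le p hBO hval hy').2
  have hJmul : ∀ m n, J m * J n ≤ J (m + n) := by
    intro m n
    rw [Ideal.mul_le]
    intro r hr s hs
    rw [hJmem] at hr hs ⊢
    rw [map_mul, pow_add, ← div_mul_div_comm]
    exact C.mul_mem hr hs
  have hJpow : ∀ m, origin p ^ m ≤ J m := by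
    intro m
    induction m with
    | zero => exact hJ0
    | succ m ih => rw [pow_succ]; exact (Ideal.mul_mono ih hJ1).trans (hJmul m 1)
  -- `O ≤ B'`
  refine le_antisymm htarget fun h hh => ?_
  have hh1 : ordVK p h ≤ 1 := (mem_O_iff p h).mp hh
  obtain ⟨a, b, hb, rfl⟩ := IsFractionRing.div_surjective (A := Poly p) h
  have hb0 : b ≠ 0 := nonZeroDivisors.ne_zero hb
  by_cases ha0 : a = 0
  · rw [ha0, map_zero, zero_div]; exact zero_mem _
  obtain ⟨m, hm⟩ := ENat.ne_top_iff_exists.mp (ord_ne_top p hb0)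
  obtain ⟨n, hn⟩ := ENat.ne_top_iff_exists.mp (ord_ne_top p ha0)
  have hvb : ordVK p (algebraMap (Poly p) (K p) b) = expNeg m := by rw [ordVK_algebraMap, ordV_eq_expNeg p hb0 hm.symm]
  have hva : ordVK p (algebraMap (Poly p) (K p) a) = expNeg n := by rw [ordVK_algebraMap, ordV_eq_expNeg p ha0 hn.symm]
  have hmn : m ≤ n := by
    rw [map_div₀, hva, hvb, div_le_one₀ (pos_iff_ne_zero.mpr (expNeg_ne_zero m)), expNeg_le_expNeg] at hh1
    exact hh1
  have haJ : a ∈ J m := hJpow m ((le_ord_iff_mem_origin_pow p a m).mp (by rw [← hn]; exact_mod_cast hmn))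
  have hbJ : b ∈ J m := hJpow m ((le_ord_iff_mem_origin_pow p b m).mp (by rw [← hm]))
  rw [hJmem] at haJ hbJ
  -- the denominator `b / u₀ᵐ` has value `1`
  have hden' : ordVK p (algebraMap (Poly p) (K p) b / (u₀ : K p) ^ m) = 1 := by
    rw [map_div₀, map_pow, hvb, hu₀v, expNeg_one_pow, div_self (expNeg_ne_zero m)]
  have hden : (O p).valuation (algebraMap (Poly p) (K p) b / (u₀ : K p) ^ m) = 1 :=
    hequiv.eq_one_iff_eq_one.mp hden'
  refine ⟨_, haJ, _, hbJ, hden, ?_⟩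
  rw [div_div_div_cancel_right₀ (pow_ne_zero _ hu₀0)]

end OrdWitness

end Summit.ResolutionOfSingularities.ResolutionOfSingularities.Theorems.CleanModels.Negative

end
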